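import Literature.NumberTheory.EllipticCurves.Wuthrich2014.MainConjectureConverseProofs
import Literature.NumberTheory.EllipticCurves.Rank1Residual.Typed.X10
import Literature.NumberTheory.EllipticCurves.BSDSelmerPConverseSerreProofs
import Literature.NumberTheory.EllipticCurves.PAdicBSD
import HarnessLib

/-!
# X10 ∧ r = 0 ∧ surj(3) WITHOUT Yan–Zhu: the missing lower bound IS Mazur's main conjecture at `(E, 3)` — and the main conjecture is a theorem wherever the per-curve lever closes `BSD(E,3)`

HONEST FRAMING (cell `b2b-bsdres`, run/shared/lean/b2b/bsd-rank1-residual/, verbatim): the goal of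
the cell is to DELETE the COMBINATION-SHAPED residual classes for ALL analytic-rank `≤ 1` elliptic
curves over `ℚ` — "full BSD formula for every rank `≤ 1` curve in class C" assembled STRICTLY from
published theorems — so that the rank-`≤ 1` remainder becomes exactly the CONSTRUCTION-SHAPED
classes, which are TYPED (missing-input `Prop`s), NOT attempted. This is not "finishing BSD".

Theorems only (no definition, no new named fact; D-0014). Unit `b2b-bsdres-x10` (X10 prover), gen 5.

**Setting.** X10a′ := X10 ∧ surj(3) (`p = 3` good ordinary, `E[3]` irreducible, mod-`3` image all of
`GL₂(𝔽₃)`) is closed as a CLASS only through Yan–Zhu, J. Algebra (2026) Thm. 4.15, whose proof at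
`p = 3` invokes Beilinson–Flach reciprocity laws printed for `p ≥ 5` only (literal flag
`YZ26@3-BF-ERL-Ohta`, HOME/X10-AUDIT.md §8). `Typed/X10.lean` (Appendix) records what the rank-`0`
branch retains from PUBLISHED inputs alone: the Euler-system half `ord_3 #Ш ≤ ord_3 #Ш_an`
(Wuthrich 2014 Prop. 21), so that the missing input there is EXACTLY the lower bound
`Typed.MissingLowerBoundAt W 3`. THIS file identifies that lower bound: granted the PUBLISHED named
facts Kato 2004 Thm. 17.4 (3) (`kato_divisibility`, integral clause under surjectivity of
`ρ_{E,3^∞}` — which at a GOOD prime `3` follows from surj(3) by Wuthrich 2014 Lemma 20, named fact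
`lemma20_surjective_threeAdic_of_semistable`), Greenberg LNM 1716 Thm. 4.1
(`greenberg_charValue_rankZero`), modularity with an integral Manin constant, Gross–Zagier–Kolyvagin,
and the period-unit hypothesis `ord_p(Ω⁺_f/Ω_E) = 0` at an irreducible good odd `p` (inline `hϖ`, the
spelling of `Summits/…/Rank1ResidualX9RankZero.lean`; Skinner–Urban 2014 p. 45),

  `MissingLowerBoundAt W 3`  ⟺  Mazur's cyclotomic main conjecture for `(E, 3)` (Néron normalisation)
                             ⟺  `MissingPPartAt W 3`  ⟺  Miller's `BSD(E, 3)`,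

on X10a′ ∧ r = 0 — the surjective-image twin of the cell's X1 ∩ {r = 0} theorem
`Wuthrich2014.mainConjecture_iff_bsdp` (reducible image, Wuthrich Thm. 16 in place of Kato's clause
(3)). The argument is Greenberg's (LNM 1716 §5, closing examples): Kato's INTEGRAL divisibility
`L_p(f, α) = ι(h · f_E)` and the Euler-characteristic formula give
`ord_p(L(E,1)/Ω_E) + 2 ord_p #E(ℚ)_tors = ord_p h(0) + ord_p ∏ c_ℓ + ord_p #Ш` with `ord_p h(0) ≥ 0`
(the one-sided inequality = Prop. 21's content at a surjective prime, re-derived here from Kato's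
theorem); the REVERSE inequality forces `ord_p h(0) = 0`, so `h ∈ Λ^× = ℤ_p⟦T⟧^×`
(`PowerSeries.isUnit_iff_constantCoeff`) and `char_Λ X = (f_E) = (g)`, `ι g = ϖ · L_p(f, α)`.

**Consequences recorded for the cell (no label change; the lane books nothing from this file).**
(i) On X10a′ ∧ r = 0 the flag `YZ26@3-BF-ERL-Ohta` bites on EXACTLY one statement: Mazur's main
conjecture at a good ordinary surjective `3` off (ram) — the Skinner–Urban direction (SU 2014 Thm.
3.6.9 needs (ram), which the class's rank-`0` clause negates; Kato gives the other direction). (ii) At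
every X10a′ rank-`0` pair where `BSD(E,3)` is closed per curve from PUBLISHED inputs — lever L1
`3 ∤ #Ш_an` (Wuthrich Prop. 21: `3136g1@3`, `8624b1@3`, …) or Prop. 21 + Cassels–Tate + a `3`-descent
certificate `3 ∣ #Ш` (`9800i1@3`, `15376i1@3`, `15376k1@3`, `15488h1@3`, X10-AUDIT §9.9) — Mazur's
main conjecture for `(E, 3)` is a THEOREM of the published record plus that certificate, with no
Beilinson–Flach input (`X10.mainConjecture_three_of_surj_of_shaAn_unit`,
`X10.mainConjecture_three_of_surj_of_casselsTate_of_three_dvd`).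

Contents:
* `chain_of_divisibility` — generic core (any image): from ONE integral divisibility datum
  `ι g = ϖ · L_p(f, α)`, `g ∈ char_Λ X`, at a cyclotomic datum, the one-sided inequality AND
  (reverse inequality ⇒ main conjecture at that datum);
* `divisibility_of_kato_of_surjective_pow` — Kato's clause (3) + `ρ_{E,p^∞}` surjective +
  `ord_p ϖ = 0` ⇒ the Néron-normalised divisibility datum;
* `missingUpperBoundAt_of_kato_of_surjective_pow`, `mainConjecture_of_missingLowerBoundAt_of_kato`,
  `mainConjecture_of_bsdp_of_kato`, `mainConjecture_iff_missingLowerBoundAt_of_kato`,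
  `mainConjecture_iff_bsdp_of_kato` — odd good ordinary `p`, `ρ_{E,p^∞}` surjective, `L(E,1) ≠ 0`;
* `X10.*_three_*` — the X10a′ ∧ r = 0 instances at `p = 3` (surj(3) + Lemma 20).

References: [Kato2004Asterisque] Thm. 17.4 (3) (p. 273), Thm. 12.5 (4); [GreenbergLNM1716] Thm. 4.1,
§5 (closing examples); [Wuthrich2014] Lemma 20, Prop. 21 (p. 400); [CastellaEtAl2021] Thm. 5.1.4
(proof); [SkinnerUrban2014] Thm. 3.6.9 (p. 45), §3.6.7; [Miller2011LMS] Def. 1.1;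
[YanZhu2024MainConjNonCM] Thm. 4.9 / 4.15; cell files X10-AUDIT.md §8, §9.8–9.9, Typed/X10.lean.
-/

set_option autoImplicit false

noncomputable section

open scoped Classical MatrixGroups ModularForm

open CongruenceSubgroup WeierstrassCurve Literature.NumberTheory.EllipticCurves
  Literature.NumberTheory.EllipticCurves.ModularForms
  Literature.NumberTheory.EllipticCurves.Wuthrich2014

namespace Literature.NumberTheory.EllipticCurves.Rank1Residual

/-! ### The generic core: one integral divisibility datum -/

/-- **The chain from ONE integral divisibility datum (any image).** Let `W` be a globally minimal model
of `E/ℚ`, `p ≠ 2` a prime of good ordinary reduction (`hgood`, `hord`), `L(E,1) ≠ 0` (`hL`), `Ш(E/ℚ)`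
finite (`hfin`); Greenberg's Thm. 4.1 (`hGr`, named fact `greenberg_charValue_rankZero`). Fix a
cyclotomic datum (`κ, γ` matching the cyclotomic variable), a newform `f` of `E` (`hf`), a
Pontryagin-dual datum `D` (`X = D.X`), a rational `ϖ` with `ϖ · Ω_E = Ω⁺_f` (`hϖ`), and suppose the
INTEGRAL DIVISIBILITY DATUM `hdiv`: `X` is `Λ`-torsion and `ϖ · L_p(f, α) = ι g` for some
`g ∈ char_Λ X` (Wuthrich Thm. 16 at a reducible `p`; Kato Thm. 17.4 (3) at a `p`-adically surjective
`p`, `divisibility_of_kato_of_surjective_pow`). Then `L(E,1)/Ω_E` is a rational `t` with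
(a) `ord_p #Ш + ord_p ∏ c_ℓ - 2 ord_p #E(ℚ)_tors ≤ ord_p t`, and (b) if conversely
`ord_p t ≤ ord_p #Ш + ord_p ∏ c_ℓ - 2 ord_p #E(ℚ)_tors` then Mazur's main conjecture holds at this
datum: `char_Λ X = (g)` with `ι g = ϖ · L_p(f, α)`. Proof: `g = h · f_E` for a generator `f_E`;
interpolation `g(0) = (1 - α⁻¹)² t`; Thm. 4.1; the anomalous factor cancels; so
`ord_p t + 2 ord_p #E(ℚ)_tors = ord_p h(0) + ord_p ∏ c_ℓ + ord_p #Ш`, `ord_p h(0) ≥ 0` — (a); under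
(b) `ord_p h(0) = 0`, `h ∈ Λ^×` (`PowerSeries.isUnit_iff_constantCoeff`), `(g) = (f_E)`. This is
`Wuthrich2014.mainConjecture_of_padicValRat_le` (x1b) with the divisibility abstracted from its
source. [cite: GreenbergLNM1716, Thm. 4.1 (p. 102) and §5 (closing examples)]
[cite: CastellaEtAl2021, Thm. 5.1.4 (proof, §5.1.3)] [cite: Kato2004Asterisque, Thm. 17.4 (3) (p. 273)] -/
theorem chain_of_divisibility (hGr : greenberg_charValue_rankZero)
    (W : WeierstrassCurve ℚ) [W.IsElliptic] [W.IsGloballyMinimal] (p : ℕ) [Fact p.Prime]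
    (hp : p ≠ 2) (hgood : W.HasGoodReductionAtPrime p) (hord : ¬ (p : ℤ) ∣ W.frobeniusTrace p)
    (hL : W.entireLFunction 1 ≠ 0) (hfin : Finite W.sha)
    {κ : ZpExtension ℚ p} {γ : Field.absoluteGaloisGroup ℚ} {N : ℕ} [NeZero N]
    {f : CuspForm (Gamma0 N) 2} (hκ : κ.IsCyclotomic) (hγ : κ.IsTopGenerator γ)
    (hγ' : IsCyclotomicVariable p γ) (hf : IsNewformOf W f) (D : W.SelmerDualData κ γ) (ϖ : ℚ)
    (hϖ : (ϖ : ℝ) * W.realPeriodRat = plusPeriod f)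
    (hdiv : D.IsTorsion ∧ ∃ g ∈ D.charIdeal, iwasawaToPowerSeries p g =
        PowerSeries.C ((ϖ : ℚ) : ℚ_[p]) * padicLFunction f (unitRoot W p : ℚ_[p])) :
    ∃ t : ℚ, W.entireLFunction 1 / (W.realPeriodRat : ℂ) = (t : ℂ) ∧
      (padicValNat p W.shaOrder : ℤ) + padicValNat p W.tamagawaProduct -
          2 * padicValNat p W.torsionOrder ≤ padicValRat p t ∧
      (padicValRat p t ≤ (padicValNat p W.shaOrder : ℤ) + padicValNat p W.tamagawaProduct -
          2 * padicValNat p W.torsionOrder →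
        D.IsTorsion ∧ ∃ g : IwasawaAlgebra p, D.charIdeal = Ideal.span {g} ∧
          iwasawaToPowerSeries p g =
            PowerSeries.C ((ϖ : ℚ) : ℚ_[p]) * padicLFunction f (unitRoot W p : ℚ_[p])) := by
  have hpP : p.Prime := Fact.out
  have hordp : IsOrdinaryAt W p := ⟨hgood, hord⟩
  -- Step 0: the rational number `t = ϖ · [0]⁺_f = L(E,1)/Ω_E`, non-zero
  have hΩpos : 0 < W.realPeriodRat := W.realPeriodRat_pos_holds
  have hϖ0 : ϖ ≠ 0 := by
    rintro rfl
    have hper : 0 < plusPeriod f := IsNewform0.plusPeriod_pos_holds hf.1 hf.coeffField_eq_bot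
    rw [← hϖ, Rat.cast_zero, zero_mul] at hper
    exact lt_irrefl _ hper
  set s : ℚ := ratPlusSymbol f 0 with hs_def
  set t : ℚ := ϖ * s with ht_def
  have hLval : W.entireLFunction 1 = (((s : ℝ) * plusPeriod f : ℝ) : ℂ) := hf.entireLFunction_one_eq
  have hq : W.entireLFunction 1 / (W.realPeriodRat : ℂ) = ((t : ℚ) : ℂ) := by
    rw [hLval, ← hϖ, div_eq_iff (Complex.ofReal_ne_zero.mpr hΩpos.ne'), ht_def]
    push_cast
    ring
  have hs0 : s ≠ 0 := by
    intro h0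
    apply hL
    rw [hLval, h0]
    simp
  have ht0 : t ≠ 0 := mul_ne_zero hϖ0 hs0
  -- Step 1 (the Iwasawa module)
  haveI : Module.Finite (IwasawaAlgebra p) D.X := D.module_finite_holds hγ
  -- Step 2 (the divisibility datum): `X` torsion and `ι g = ϖ · L_p(f, α)` for some `g ∈ char_Λ X`;
  -- a generator `fE` of the (principal) characteristic ideal, and the cofactor `h`: `g = h · fE`
  obtain ⟨hX, g, hgmem, hιg⟩ := hdiv
  haveI : (Module.charIdeal (IwasawaAlgebra p) D.X).IsPrincipal := charIdeal_isPrincipal_holds p D.X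
  obtain ⟨fE, hchar⟩ := Submodule.IsPrincipal.principal (Module.charIdeal (IwasawaAlgebra p) D.X)
  have hchar' : D.charIdeal = Ideal.span {fE} := hchar
  have hgmem' : g ∈ Ideal.span {fE} := by rw [← hchar']; exact hgmem
  obtain ⟨h, hgh⟩ := Ideal.mem_span_singleton'.mp hgmem'
  -- Step 3 (interpolation): `g(0) = ϖ · (1 - α⁻¹)² [0]⁺_f = (1 - α⁻¹)² · t`
  set a : ℚ_[p] := ((unitRoot W p : ℤ_[p]) : ℚ_[p]) with ha
  have htcast : ((t : ℚ) : ℚ_[p]) = (ϖ : ℚ_[p]) * (s : ℚ_[p]) := by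
    rw [ht_def]; push_cast; ring
  have hg0 : ((PowerSeries.constantCoeff g : ℤ_[p]) : ℚ_[p]) = (1 - a⁻¹) ^ 2 * (t : ℚ_[p]) := by
    rw [← constantCoeff_iwasawaToPowerSeries p g, hιg, map_mul, PowerSeries.constantCoeff_C,
      constantCoeff_padicLFunction_unitRoot hordp hf, htcast]
    ring
  -- `g(0) = h(0) · fE(0)`
  have hg0' : (PowerSeries.constantCoeff g : ℤ_[p]) =
      PowerSeries.constantCoeff h * PowerSeries.constantCoeff fE := by
    rw [← hgh, map_mul]
  -- the bridges `1 - α⁻¹ = u₂ · #Ẽ(𝔽_p)` and `#Ẽ(𝔽_p) = u₃ · #Ẽ(𝔽_p)(p)`; in particular `1 - α⁻¹ ≠ 0`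
  obtain ⟨u₂, hu₂⟩ := exists_unit_one_sub_unitRoot_inv p W hordp
  haveI : NeZero p := ⟨hpP.ne_zero⟩
  obtain ⟨u₃, hu₃⟩ := exists_unit_natCard_eq_mul_card_primaryComponent
    ((integralModelInt W).map (Int.castRingHom (ZMod p))).toAffine.Point p
  set Np : ℚ_[p] := (Nat.card (AddCommGroup.primaryComponent
    ((integralModelInt W).map (Int.castRingHom (ZMod p))).toAffine.Point p) : ℚ_[p]) with hNp
  have hNcount : (W.reductionPointCount p : ℚ_[p]) = ((u₃ : ℤ_[p]) : ℚ_[p]) * Np := by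
    rw [WeierstrassCurve.reductionPointCount, hNp]
    exact hu₃
  have hNp0 : Np ≠ 0 := by
    rw [hNp]
    exact_mod_cast Nat.card_pos.ne'
  have h1 : (1 - a⁻¹) = ((u₂ : ℤ_[p]) : ℚ_[p]) * ((u₃ : ℤ_[p]) : ℚ_[p]) * Np := by
    rw [hu₂, hNcount, mul_assoc]
  have htQ0 : (t : ℚ_[p]) ≠ 0 := by exact_mod_cast ht0
  have hU0 : ((u₂ : ℤ_[p]) : ℚ_[p]) * ((u₃ : ℤ_[p]) : ℚ_[p]) ≠ 0 :=
    mul_ne_zero (coe_units_ne_zero p u₂) (coe_units_ne_zero p u₃)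
  -- Step 4 (finiteness): `g(0) ≠ 0`, hence `fE(0) ≠ 0` and `h(0) ≠ 0`, so `Sel_{p^∞}(E/ℚ)` and
  -- `E(ℚ)` are finite (Greenberg p. 103); `Ш` is finite by hypothesis
  have hg00 : PowerSeries.constantCoeff g ≠ 0 := by
    intro h0
    rw [h0, PadicInt.coe_zero, h1] at hg0
    exact (mul_ne_zero (pow_ne_zero 2 (mul_ne_zero hU0 hNp0)) htQ0) hg0.symm
  have hfE00 : PowerSeries.constantCoeff fE ≠ 0 := by
    intro h0
    apply hg00
    rw [hg0', h0, mul_zero]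
  have hh00 : PowerSeries.constantCoeff h ≠ 0 := by
    intro h0
    apply hg00
    rw [hg0', h0, zero_mul]
  have hSelfin : Finite (W.selmerGroupPInfty p) :=
    D.finite_selmerGroupPInfty_of_constantCoeff_ne_zero W hγ hX fE hchar' hfE00
  obtain ⟨hEfin, hShapfin⟩ := (W.finite_selmerGroupPInfty_iff p).mp hSelfin
  haveI := hEfin
  haveI := hShapfin
  haveI := hSelfin
  haveI : Finite W.sha := hfin
  -- Step 5 (Greenberg's Thm. 4.1 — the named fact — for the generator `fE`)
  obtain ⟨u₁, hu₁⟩ := hGr W p hp hgood hord κ γ hκ hγ hγ' D hX fE hchar' hSelfin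
  -- Step 6 (the remaining bridges)
  obtain ⟨u₄, hu₄⟩ := exists_unit_torsionOrder_eq W p
  obtain ⟨u₅, hu₅⟩ := exists_unit_natCard_eq_mul_card_primaryComponent W.sha p
  have hSel : Nat.card (W.selmerGroupPInfty p) = Nat.card (AddCommGroup.primaryComponent W.sha p) :=
    W.natCard_selmerGroupPInfty_eq_natCard_primaryComponent_sha p
  -- abbreviations
  set v := padicValNat p W.tamagawaProduct with hv
  set Tp : ℚ_[p] := (Nat.card (AddCommGroup.primaryComponent W.toAffine.Point p) : ℚ_[p]) with hTp
  set Shp : ℚ_[p] := (Nat.card (AddCommGroup.primaryComponent W.sha p) : ℚ_[p]) with hShp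
  set h0 : ℚ_[p] := ((PowerSeries.constantCoeff h : ℤ_[p]) : ℚ_[p]) with hh0
  have hh0ne : h0 ≠ 0 := by
    rw [hh0]
    intro h0'
    exact hh00 (by exact_mod_cast (PadicInt.coe_eq_zero.mp h0'))
  have hh0val : 0 ≤ h0.valuation := by
    rw [hh0]
    exact PadicInt.valuation_coe_nonneg
  -- `#E(ℚ)_tors = u₄ · Tp` (up to the `DecidableEq ℚ` instance inside the group law)
  have hu₄' : (W.torsionOrder : ℚ_[p]) = ((u₄ : ℤ_[p]) : ℚ_[p]) * Tp := by
    rw [hu₄, hTp]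
    congr 1
    exact_mod_cast natCard_primaryComponent_point_congr W p _ _
  -- `#Ш = u₅ · Shp`, `#Sel = Shp`
  have hSha : (W.shaOrder : ℚ_[p]) = ((u₅ : ℤ_[p]) : ℚ_[p]) * Shp := by
    rw [WeierstrassCurve.shaOrder, hShp]
    exact hu₅
  have hSel' : (Nat.card (W.selmerGroupPInfty p) : ℚ_[p]) = Shp := by rw [hShp, hSel]
  -- `g(0) = h0 · fE(0)` in `ℚ_p`
  have hg0Q : ((PowerSeries.constantCoeff g : ℤ_[p]) : ℚ_[p]) =
      h0 * ((PowerSeries.constantCoeff fE : ℤ_[p]) : ℚ_[p]) := by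
    rw [hg0', hh0]; push_cast; ring
  -- Step 7: the identity `t · Tp² · (u₂ u₃)² = h0 · u₁ · p^v · Shp` in `ℚ_p`
  have key : (t : ℚ_[p]) * Tp ^ 2 * (((u₂ : ℤ_[p]) : ℚ_[p]) * ((u₃ : ℤ_[p]) : ℚ_[p])) ^ 2 =
      h0 * (((u₁ : ℤ_[p]) : ℚ_[p]) * (p : ℚ_[p]) ^ v * Shp) := by
    apply mul_right_cancel₀ (pow_ne_zero 2 hNp0)
    calc (t : ℚ_[p]) * Tp ^ 2 * (((u₂ : ℤ_[p]) : ℚ_[p]) * ((u₃ : ℤ_[p]) : ℚ_[p])) ^ 2 * Np ^ 2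
        = ((1 - a⁻¹) ^ 2 * (t : ℚ_[p])) * Tp ^ 2 := by rw [h1]; ring
      _ = h0 * (((PowerSeries.constantCoeff fE : ℤ_[p]) : ℚ_[p]) * Tp ^ 2) := by
          rw [← hg0, hg0Q]; ring
      _ = h0 * (((u₁ : ℤ_[p]) : ℚ_[p]) * (p : ℚ_[p]) ^ v * Np ^ 2 *
            (Nat.card (W.selmerGroupPInfty p) : ℚ_[p])) := by rw [hu₁]
      _ = h0 * (((u₁ : ℤ_[p]) : ℚ_[p]) * (p : ℚ_[p]) ^ v * Shp) * Np ^ 2 := by rw [hSel']; ring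
  -- Step 8: valuations
  have hTp0 : Tp ≠ 0 := by rw [hTp]; exact_mod_cast Nat.card_pos.ne'
  have hShp0 : Shp ≠ 0 := by rw [hShp]; exact_mod_cast Nat.card_pos.ne'
  have hp0 : (p : ℚ_[p]) ≠ 0 := Nat.cast_ne_zero.mpr hpP.ne_zero
  have hval := congrArg Padic.valuation key
  rw [Padic.valuation_mul (mul_ne_zero htQ0 (pow_ne_zero 2 hTp0)) (pow_ne_zero 2 hU0),
    Padic.valuation_mul htQ0 (pow_ne_zero 2 hTp0), Padic.valuation_pow, Padic.valuation_pow,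
    Padic.valuation_mul (coe_units_ne_zero p u₂) (coe_units_ne_zero p u₃),
    valuation_coe_units_eq_zero, valuation_coe_units_eq_zero,
    Padic.valuation_mul hh0ne
      (mul_ne_zero (mul_ne_zero (coe_units_ne_zero p u₁) (pow_ne_zero v hp0)) hShp0),
    Padic.valuation_mul (mul_ne_zero (coe_units_ne_zero p u₁) (pow_ne_zero v hp0)) hShp0,
    Padic.valuation_mul (coe_units_ne_zero p u₁) (pow_ne_zero v hp0), valuation_coe_units_eq_zero,
    Padic.valuation_pow, Padic.valuation_p, Padic.valuation_ratCast] at hval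
  -- `v(Tp) = v(#E(ℚ)_tors)`, `v(Shp) = v(#Ш)`
  have hvT : Tp.valuation = (padicValNat p W.torsionOrder : ℤ) := by
    have h := congrArg Padic.valuation hu₄'
    rw [Padic.valuation_natCast, Padic.valuation_mul (coe_units_ne_zero p u₄) hTp0,
      valuation_coe_units_eq_zero, zero_add] at h
    exact h.symm
  have hvS : Shp.valuation = (padicValNat p W.shaOrder : ℤ) := by
    have h := congrArg Padic.valuation hSha
    rw [Padic.valuation_natCast, Padic.valuation_mul (coe_units_ne_zero p u₅) hShp0,
      valuation_coe_units_eq_zero, zero_add] at h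
    exact h.symm
  rw [hvT, hvS] at hval
  simp only [Nat.cast_ofNat, mul_zero, add_zero, zero_add] at hval
  refine ⟨t, hq, by linarith, fun hle => ?_⟩
  -- Step 9: the reverse inequality forces `ord_p h(0) = 0`, so `h(0) ∈ ℤ_p^×` and `h ∈ Λ^×`
  have hh0zero : h0.valuation = 0 := by linarith
  have hvalh : (PowerSeries.constantCoeff h : ℤ_[p]).valuation = 0 := by
    have h' : (((PowerSeries.constantCoeff h : ℤ_[p]) : ℚ_[p])).valuation = 0 := by
      rw [← hh0]; exact hh0zero
    rw [PadicInt.valuation_coe] at h'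
    exact_mod_cast h'
  have hunit0 : IsUnit (PowerSeries.constantCoeff h : ℤ_[p]) := by
    rw [PadicInt.isUnit_iff, PadicInt.norm_eq_zpow_neg_valuation hh00, hvalh]
    simp
  have hunit : IsUnit h := PowerSeries.isUnit_iff_constantCoeff.mpr hunit0
  -- Step 10: `char_Λ X = (fE) = (h · fE) = (g)`
  refine ⟨hX, g, ?_, hιg⟩
  rw [hchar', ← hgh, Ideal.span_singleton_mul_left_unit hunit]

/-! ### Kato's clause (3) supplies the datum at a `p`-adically surjective prime -/

/-- **Kato's Thm. 17.4 (3) ⇒ the Néron-normalised divisibility datum**, at an odd good ordinary prime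
`p` with `ρ̄_{E,p^n}` surjective for every `n` (`hsurj`; condition (12.5.2)) and a period ratio `ϖ`
(`ϖ · Ω_E = Ω⁺_f`) that is a `p`-adic unit (`hϖv`; at an irreducible good odd `p`: no `p`-isogeny in
the class and `p ∤` the Manin constant — Skinner–Urban 2014 p. 45; a HYPOTHESIS here, as in
`Typed/PAdicCertificateGoodOrdinary.lean` and `Rank1ResidualX9RankZero.lean`). Kato (`hK`, named fact
`kato_divisibility`, clause (3)) gives `g₀ ∈ char_Λ X` with `ι g₀ = L_p(f, α)`; then
`g := ϖ · g₀ ∈ char_Λ X` (`ϖ ∈ ℤ_p^× ⊂ Λ`) has `ι g = ϖ · L_p(f, α)`.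
[cite: Kato2004Asterisque, Thm. 17.4 (3) (p. 273) and Thm. 12.5 (4) (p. 222)]
[cite: SkinnerUrban2014, §3.6.7 (p. 45)] -/
theorem divisibility_of_kato_of_surjective_pow
    (W : WeierstrassCurve ℚ) [W.IsElliptic] [W.IsGloballyMinimal] (p : ℕ) [Fact p.Prime]
    {κ : ZpExtension ℚ p} {γ : Field.absoluteGaloisGroup ℚ} {N : ℕ} [NeZero N]
    {f : CuspForm (Gamma0 N) 2}
    (hK : kato_divisibility W p (κ := κ) (γ := γ) (f := f))
    (hp : p ≠ 2) (hgood : W.HasGoodReductionAtPrime p) (hord : ¬ (p : ℤ) ∣ W.frobeniusTrace p)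
    (hsurj : ∀ n : ℕ, W.HasSurjectiveModNGaloisRep (p ^ n : ℕ))
    (hκ : κ.IsCyclotomic) (hγ : κ.IsTopGenerator γ) (hγ' : IsCyclotomicVariable p γ)
    (hf : IsNewformOf W f) (D : W.SelmerDualData κ γ) (ϖ : ℚ) (hϖ0 : ϖ ≠ 0)
    (hϖv : padicValRat p ϖ = 0) :
    D.IsTorsion ∧ ∃ g ∈ D.charIdeal, iwasawaToPowerSeries p g =
      PowerSeries.C ((ϖ : ℚ) : ℚ_[p]) * padicLFunction f (unitRoot W p : ℚ_[p]) := by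
  obtain ⟨hX, -, h3⟩ := hK hp ⟨hgood, hord⟩ hκ hγ hγ' hf D
  obtain ⟨g₀, hg₀, hι₀⟩ := h3 hsurj
  -- `ϖ` is a unit of `ℤ_p`
  have hnorm : ‖(ϖ : ℚ_[p])‖ = 1 := by
    rw [Padic.eq_padicNorm, padicNorm.eq_zpow_of_nonzero hϖ0, hϖv, neg_zero, zpow_zero,
      Rat.cast_one]
  set c : ℤ_[p] := ⟨(ϖ : ℚ_[p]), hnorm.le⟩ with hc_def
  refine ⟨hX, PowerSeries.C c * g₀, Ideal.mul_mem_left _ _ hg₀, ?_⟩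
  rw [map_mul, hι₀, PowerSeries.map_C]
  rfl

/-! ### Odd good ordinary `p`, `ρ_{E,p^∞}` surjective, `L(E,1) ≠ 0` -/

section Surjective

variable (W : WeierstrassCurve ℚ) [W.IsElliptic] [W.IsGloballyMinimal] (p : ℕ) [Fact p.Prime]

omit [W.IsGloballyMinimal] in
/-- `L(E,1) ≠ 0` forces every period ratio `ϖ` (`ϖ · Ω_E = Ω⁺_f`) to be non-zero
(`L(E,1) = [0]⁺_f · Ω⁺_f`). Bookkeeping. [cite: Miller2011LMS, §1] -/
theorem varpi_ne_zero_of_entireLFunction_one_ne_zero (hL : W.entireLFunction 1 ≠ 0)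
    {N : ℕ} [NeZero N] {f : CuspForm (Gamma0 N) 2} (hf : IsNewformOf W f) {ϖ : ℚ}
    (hϖ : (ϖ : ℝ) * W.realPeriodRat = plusPeriod f) : ϖ ≠ 0 := by
  have hplus : plusPeriod f ≠ 0 := by
    intro h0
    apply hL
    rw [hf.entireLFunction_one_eq, h0]
    simp
  rintro rfl
  apply hplus
  rw [← hϖ]
  simp

/-- **The Euler-system half from Kato's theorem, class-wide: `ord_p #Ш(E/ℚ) ≤ ord_p #Ш(E/ℚ)_an`** at an
odd good ordinary prime `p` with `ρ_{E,p^∞}` surjective (`hsurj`) and `L(E,1) ≠ 0`, granted Kato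
Thm. 17.4 (3) (`hK`, for the newform at level `N_E` and every cyclotomic datum), Greenberg Thm. 4.1
(`hGr`), modularity with an integral Manin constant (`hmod`), Gross–Zagier–Kolyvagin (`hGZK`, for the
finiteness of `Ш` and `E(ℚ)`), and the period unit `hϖ`. (Wuthrich 2014 Prop. 21 prints the same
conclusion; this is its derivation from Kato's theorem inside the kernel, at surjective primes.)
[cite: Kato2004Asterisque, Thm. 17.4 (3) (p. 273)] [cite: GreenbergLNM1716, Thm. 4.1 (p. 102)]
[cite: Wuthrich2014, Prop. 21 (p. 400)] [cite: Miller2011LMS, Def. 1.1 (arXiv:1010.2431 p. 3)] -/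
theorem missingUpperBoundAt_of_kato_of_surjective_pow (hGr : greenberg_charValue_rankZero)
    (hmod : nonempty_modularParametrizationData)
    (hGZK : rank_eq_analyticRank_of_analyticRank_le_one)
    (hK : ∀ (κ : ZpExtension ℚ p) (γ : Field.absoluteGaloisGroup ℚ) [NeZero (W.conductorNorm ℤ)]
      (f : CuspForm (Gamma0 (W.conductorNorm ℤ)) 2), kato_divisibility W p (κ := κ) (γ := γ) (f := f))
    (hp : p ≠ 2) (hgood : W.HasGoodReductionAtPrime p) (hord : ¬ (p : ℤ) ∣ W.frobeniusTrace p)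
    (hsurj : ∀ n : ℕ, W.HasSurjectiveModNGaloisRep (p ^ n : ℕ)) (hL : W.entireLFunction 1 ≠ 0)
    (hϖ : ∀ [NeZero (W.conductorNorm ℤ)] (f : CuspForm (Gamma0 (W.conductorNorm ℤ)) 2),
      IsNewformOf W f → ∀ ϖ : ℚ, (ϖ : ℝ) * W.realPeriodRat = plusPeriod f → padicValRat p ϖ = 0) :
    Typed.MissingUpperBoundAt W p := by
  -- finiteness of `Ш` (Gross–Zagier–Kolyvagin at analytic rank `0`)
  have hr0 : W.analyticRank = 0 := analyticRank_eq_zero_of_entireLFunction_one_ne_zero hL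
  obtain ⟨-, hfin⟩ := hGZK W (by rw [hr0]; exact zero_le_one)
  -- the newform at level `N_E` and its period ratio `ϖ` (a `p`-adic unit by `hϖ`)
  haveI : NeZero (W.conductorNorm ℤ) := ⟨(W.conductorNorm_pos_holds).ne'⟩
  obtain ⟨Dm⟩ := hmod W
  have hf : IsNewformOf W Dm.f := Dm.isNewformOf
  obtain ⟨ϖ, hϖpos, hϖeq, -⟩ := Dm.exists_rat_mul_realPeriodRat_eq_plusPeriod
  -- the cyclotomic datum, the Iwasawa module, Kato's datum, the chain
  obtain ⟨κ, hκ, γ, hγ, hγ'⟩ := exists_isCyclotomic_isTopGenerator_isCyclotomicVariable_holds p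
  obtain ⟨D⟩ := W.nonempty_selmerDualData_holds κ γ hγ
  have hdiv := divisibility_of_kato_of_surjective_pow W p (hK κ γ Dm.f) hp hgood hord hsurj hκ hγ hγ'
    hf D ϖ hϖpos.ne' (hϖ Dm.f hf ϖ hϖeq)
  obtain ⟨t, ht, hle, -⟩ :=
    chain_of_divisibility hGr W p hp hgood hord hL hfin hκ hγ hγ' hf D ϖ hϖeq hdiv
  -- Miller's currency: `#Ш_an = t · #E(ℚ)² / ∏ c_ℓ`
  obtain ⟨-, hE, -, hshaAn⟩ := shaAn_eq_of_L_one_div_eq hGZK W hL ht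
  haveI := hE
  have hΩ : (W.realPeriodRat : ℂ) ≠ 0 := by exact_mod_cast W.realPeriodRat_pos_holds.ne'
  have ht0 : t ≠ 0 := by
    rintro rfl
    apply hL
    rw [Rat.cast_zero, div_eq_zero_iff] at ht
    exact ht.resolve_right hΩ
  have hcard : (Nat.card W.toAffine.Point : ℚ) ≠ 0 := by
    exact_mod_cast (Nat.card_pos (α := W.toAffine.Point)).ne'
  have htam : (W.tamagawaProduct : ℚ) ≠ 0 := by
    exact_mod_cast (W.tamagawaProduct_pos_holds : 0 < W.tamagawaProduct).ne'
  have hcardT : (Nat.card W.toAffine.Point : ℚ) = (W.torsionOrder : ℚ) := by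
    exact_mod_cast (W.torsionOrder_eq_natCard_of_finite).symm
  refine ⟨t * (Nat.card W.toAffine.Point : ℚ) ^ 2 / (W.tamagawaProduct : ℚ), hshaAn, ?_⟩
  rw [padicValRat.div (mul_ne_zero ht0 (pow_ne_zero 2 hcard)) htam,
    padicValRat.mul ht0 (pow_ne_zero 2 hcard), padicValRat.pow, hcardT]
  simp only [padicValRat.of_nat, Nat.cast_ofNat]
  linarith

/-- **The typed lower bound ⟹ Mazur's main conjecture for `(E, p)`** at an odd good ordinary prime `p`
with `ρ_{E,p^∞}` surjective and `L(E,1) ≠ 0`. Facts: Kato Thm. 17.4 (3) (`hK`), Greenberg Thm. 4.1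
(`hGr`), Gross–Zagier–Kolyvagin (`hGZK`: rank `0`, `Ш` finite), the period unit (`hϖ`). Hypothesis:
`Typed.MissingLowerBoundAt W p` (`#Ш_an = q ∈ ℚ`, `ord_p q ≤ ord_p #Ш`). Conclusion: Mazur's main
conjecture in the Néron normalisation at every datum `(κ, γ, f, ϖ, D)` with `f` of level `N_E` —
literally the body of the Summits-side `MazurMainConjecture W p`. The surjective twin of
`Wuthrich2014.mainConjecture_of_missingLowerBoundAt`. [cite: Kato2004Asterisque, Thm. 17.4 (3) (p. 273)]
[cite: GreenbergLNM1716, Thm. 4.1 and §5 (closing examples)] [cite: Miller2011LMS, Def. 1.1 (arXiv:1010.2431 p. 3)] -/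
theorem mainConjecture_of_missingLowerBoundAt_of_kato (hGr : greenberg_charValue_rankZero)
    (hGZK : rank_eq_analyticRank_of_analyticRank_le_one)
    (hK : ∀ (κ : ZpExtension ℚ p) (γ : Field.absoluteGaloisGroup ℚ) [NeZero (W.conductorNorm ℤ)]
      (f : CuspForm (Gamma0 (W.conductorNorm ℤ)) 2), kato_divisibility W p (κ := κ) (γ := γ) (f := f))
    (hp : p ≠ 2) (hgood : W.HasGoodReductionAtPrime p) (hord : ¬ (p : ℤ) ∣ W.frobeniusTrace p)
    (hsurj : ∀ n : ℕ, W.HasSurjectiveModNGaloisRep (p ^ n : ℕ)) (hL : W.entireLFunction 1 ≠ 0)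
    (hϖ : ∀ [NeZero (W.conductorNorm ℤ)] (f : CuspForm (Gamma0 (W.conductorNorm ℤ)) 2),
      IsNewformOf W f → ∀ ϖ : ℚ, (ϖ : ℝ) * W.realPeriodRat = plusPeriod f → padicValRat p ϖ = 0)
    (hlow : Typed.MissingLowerBoundAt W p) :
    ∀ (κ : ZpExtension ℚ p) (γ : Field.absoluteGaloisGroup ℚ),
        κ.IsCyclotomic → κ.IsTopGenerator γ → IsCyclotomicVariable p γ →
      ∀ [NeZero (W.conductorNorm ℤ)] (f : CuspForm (Gamma0 (W.conductorNorm ℤ)) 2),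
        IsNewformOf W f → ∀ (ϖ : ℚ), (ϖ : ℝ) * W.realPeriodRat = plusPeriod f →
      ∀ (D : W.SelmerDualData κ γ), D.IsTorsion ∧
        ∃ g : IwasawaAlgebra p, D.charIdeal = Ideal.span {g} ∧
          iwasawaToPowerSeries p g =
            PowerSeries.C (ϖ : ℚ_[p]) * padicLFunction f (unitRoot W p : ℚ_[p]) := by
  intro κ γ hκ hγ hγ' _ f hf ϖ hϖeq D
  have hr0 : W.analyticRank = 0 := analyticRank_eq_zero_of_entireLFunction_one_ne_zero hL
  obtain ⟨-, hfin⟩ := hGZK W (by rw [hr0]; exact zero_le_one)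
  have hϖ0 : ϖ ≠ 0 := varpi_ne_zero_of_entireLFunction_one_ne_zero W hL hf hϖeq
  have hdiv := divisibility_of_kato_of_surjective_pow W p (hK κ γ f) hp hgood hord hsurj hκ hγ hγ' hf
    D ϖ hϖ0 (hϖ f hf ϖ hϖeq)
  obtain ⟨t, ht, -, hconv⟩ :=
    chain_of_divisibility hGr W p hp hgood hord hL hfin hκ hγ hγ' hf D ϖ hϖeq hdiv
  apply hconv
  -- the reverse inequality at `t`, from the typed lower bound in Miller's currency
  obtain ⟨-, hE, -, hshaAn⟩ := shaAn_eq_of_L_one_div_eq hGZK W hL ht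
  haveI := hE
  obtain ⟨q', hq', hle'⟩ := hlow
  have hqq : q' = t * (Nat.card W.toAffine.Point : ℚ) ^ 2 / (W.tamagawaProduct : ℚ) := by
    exact_mod_cast hq'.symm.trans hshaAn
  have hΩ : (W.realPeriodRat : ℂ) ≠ 0 := by exact_mod_cast W.realPeriodRat_pos_holds.ne'
  have ht0 : t ≠ 0 := by
    rintro rfl
    apply hL
    rw [Rat.cast_zero, div_eq_zero_iff] at ht
    exact ht.resolve_right hΩ
  have hcard : (Nat.card W.toAffine.Point : ℚ) ≠ 0 := by
    exact_mod_cast (Nat.card_pos (α := W.toAffine.Point)).ne'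
  have htam : (W.tamagawaProduct : ℚ) ≠ 0 := by
    exact_mod_cast (W.tamagawaProduct_pos_holds : 0 < W.tamagawaProduct).ne'
  have hcardT : (Nat.card W.toAffine.Point : ℚ) = (W.torsionOrder : ℚ) := by
    exact_mod_cast (W.torsionOrder_eq_natCard_of_finite).symm
  rw [hqq, padicValRat.div (mul_ne_zero ht0 (pow_ne_zero 2 hcard)) htam,
    padicValRat.mul ht0 (pow_ne_zero 2 hcard), padicValRat.pow, hcardT] at hle'
  simp only [padicValRat.of_nat, Nat.cast_ofNat] at hle'
  linarith

/-- **`BSD(E, p)` ⟹ Mazur's main conjecture for `(E, p)`** at an odd good ordinary `p` with `ρ_{E,p^∞}`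
surjective and `L(E,1) ≠ 0` (same facts). Miller's `BSDp W p` contains `ord_p #Ш_an = ord_p #Ш(p)`,
i.e. for finite `Ш` the typed output `MissingPPartAt W p`, whose lower half feeds
`mainConjecture_of_missingLowerBoundAt_of_kato`. So every per-curve certified instance of the rank-`0`
BSD formula at such a prime is an instance of Mazur's main conjecture proved from the published record
plus that certificate — with no (ram) hypothesis (Skinner–Urban 2014 Thm. 3.6.9) and no Beilinson–Flach
input (Yan–Zhu 2026 Thm. 4.9). [cite: Kato2004Asterisque, Thm. 17.4 (3) (p. 273)]
[cite: GreenbergLNM1716, §5 (closing examples)] [cite: SkinnerUrban2014, Thm. 3.6.9 (p. 45)]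
[cite: Miller2011LMS, Def. 1.1 (arXiv:1010.2431 p. 3)] -/
theorem mainConjecture_of_bsdp_of_kato (hGr : greenberg_charValue_rankZero)
    (hGZK : rank_eq_analyticRank_of_analyticRank_le_one)
    (hK : ∀ (κ : ZpExtension ℚ p) (γ : Field.absoluteGaloisGroup ℚ) [NeZero (W.conductorNorm ℤ)]
      (f : CuspForm (Gamma0 (W.conductorNorm ℤ)) 2), kato_divisibility W p (κ := κ) (γ := γ) (f := f))
    (hp : p ≠ 2) (hgood : W.HasGoodReductionAtPrime p) (hord : ¬ (p : ℤ) ∣ W.frobeniusTrace p)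
    (hsurj : ∀ n : ℕ, W.HasSurjectiveModNGaloisRep (p ^ n : ℕ)) (hL : W.entireLFunction 1 ≠ 0)
    (hϖ : ∀ [NeZero (W.conductorNorm ℤ)] (f : CuspForm (Gamma0 (W.conductorNorm ℤ)) 2),
      IsNewformOf W f → ∀ ϖ : ℚ, (ϖ : ℝ) * W.realPeriodRat = plusPeriod f → padicValRat p ϖ = 0)
    (hbsd : BSDp W p) :
    ∀ (κ : ZpExtension ℚ p) (γ : Field.absoluteGaloisGroup ℚ),
        κ.IsCyclotomic → κ.IsTopGenerator γ → IsCyclotomicVariable p γ →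
      ∀ [NeZero (W.conductorNorm ℤ)] (f : CuspForm (Gamma0 (W.conductorNorm ℤ)) 2),
        IsNewformOf W f → ∀ (ϖ : ℚ), (ϖ : ℝ) * W.realPeriodRat = plusPeriod f →
      ∀ (D : W.SelmerDualData κ γ), D.IsTorsion ∧
        ∃ g : IwasawaAlgebra p, D.charIdeal = Ideal.span {g} ∧
          iwasawaToPowerSeries p g =
            PowerSeries.C (ϖ : ℚ_[p]) * padicLFunction f (unitRoot W p : ℚ_[p]) := by
  have hr0 : W.analyticRank = 0 := analyticRank_eq_zero_of_entireLFunction_one_ne_zero hL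
  obtain ⟨-, hfin⟩ := hGZK W (by rw [hr0]; exact zero_le_one)
  haveI : Finite W.sha := hfin
  exact mainConjecture_of_missingLowerBoundAt_of_kato W p hGr hGZK hK hp hgood hord hsurj hL hϖ
    (Typed.lower_and_upper_of_missingPPartAt W p (Typed.missingPPartAt_of_bsdp W p hbsd)).1

/-- **Mazur's main conjecture ⟺ the typed lower bound** at an odd good ordinary prime `p` with
`ρ_{E,p^∞}` surjective and `L(E,1) ≠ 0`, granted the PUBLISHED named facts Kato Thm. 17.4 (3) (`hK`),
Greenberg Thm. 4.1 (`hGr`), modularity with an integral Manin constant (`hmod`), Gross–Zagier–Kolyvagin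
(`hGZK`) and the period unit (`hϖ`): the main conjecture for `(E, p)` (Néron normalisation, every datum,
newform of level `N_E`) holds IF AND ONLY IF `ord_p #Ш(E/ℚ)_an ≤ ord_p #Ш(E/ℚ)`. (⇒ is
Castella–Grossi–Lee–Skinner's glue `Wuthrich2014.missingPPartAt_of_mainConjecture`, image-free.)
[cite: Kato2004Asterisque, Thm. 17.4 (3) (p. 273)] [cite: GreenbergLNM1716, Thm. 4.1 and §5 (closing examples)]
[cite: CastellaEtAl2021, Thm. 5.1.4 (proof)] -/
theorem mainConjecture_iff_missingLowerBoundAt_of_kato (hGr : greenberg_charValue_rankZero)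
    (hmod : nonempty_modularParametrizationData)
    (hGZK : rank_eq_analyticRank_of_analyticRank_le_one)
    (hK : ∀ (κ : ZpExtension ℚ p) (γ : Field.absoluteGaloisGroup ℚ) [NeZero (W.conductorNorm ℤ)]
      (f : CuspForm (Gamma0 (W.conductorNorm ℤ)) 2), kato_divisibility W p (κ := κ) (γ := γ) (f := f))
    (hp : p ≠ 2) (hgood : W.HasGoodReductionAtPrime p) (hord : ¬ (p : ℤ) ∣ W.frobeniusTrace p)
    (hsurj : ∀ n : ℕ, W.HasSurjectiveModNGaloisRep (p ^ n : ℕ)) (hL : W.entireLFunction 1 ≠ 0)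
    (hϖ : ∀ [NeZero (W.conductorNorm ℤ)] (f : CuspForm (Gamma0 (W.conductorNorm ℤ)) 2),
      IsNewformOf W f → ∀ ϖ : ℚ, (ϖ : ℝ) * W.realPeriodRat = plusPeriod f → padicValRat p ϖ = 0) :
    (∀ (κ : ZpExtension ℚ p) (γ : Field.absoluteGaloisGroup ℚ),
        κ.IsCyclotomic → κ.IsTopGenerator γ → IsCyclotomicVariable p γ →
      ∀ [NeZero (W.conductorNorm ℤ)] (f : CuspForm (Gamma0 (W.conductorNorm ℤ)) 2),
        IsNewformOf W f → ∀ (ϖ : ℚ), (ϖ : ℝ) * W.realPeriodRat = plusPeriod f →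
      ∀ (D : W.SelmerDualData κ γ), D.IsTorsion ∧
        ∃ g : IwasawaAlgebra p, D.charIdeal = Ideal.span {g} ∧
          iwasawaToPowerSeries p g =
            PowerSeries.C (ϖ : ℚ_[p]) * padicLFunction f (unitRoot W p : ℚ_[p])) ↔
    Typed.MissingLowerBoundAt W p := by
  constructor
  · intro hMC
    exact (Typed.lower_and_upper_of_missingPPartAt W p
      (missingPPartAt_of_mainConjecture hGr hmod hGZK W p hp hgood hord hL hMC)).1
  · exact mainConjecture_of_missingLowerBoundAt_of_kato W p hGr hGZK hK hp hgood hord hsurj hL hϖ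

/-- **Mazur's main conjecture ⟺ Miller's `BSD(E, p)`** at an odd good ordinary prime `p` with
`ρ_{E,p^∞}` surjective and `L(E,1) ≠ 0` (same facts as
`mainConjecture_iff_missingLowerBoundAt_of_kato`): the two statements about such a pair coincide on
the published record. [cite: Kato2004Asterisque, Thm. 17.4 (3) (p. 273)]
[cite: GreenbergLNM1716, Thm. 4.1 and §5 (closing examples)] [cite: Miller2011LMS, Def. 1.1 (arXiv:1010.2431 p. 3)] -/
theorem mainConjecture_iff_bsdp_of_kato (hGr : greenberg_charValue_rankZero)
    (hmod : nonempty_modularParametrizationData)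
    (hGZK : rank_eq_analyticRank_of_analyticRank_le_one)
    (hK : ∀ (κ : ZpExtension ℚ p) (γ : Field.absoluteGaloisGroup ℚ) [NeZero (W.conductorNorm ℤ)]
      (f : CuspForm (Gamma0 (W.conductorNorm ℤ)) 2), kato_divisibility W p (κ := κ) (γ := γ) (f := f))
    (hp : p ≠ 2) (hgood : W.HasGoodReductionAtPrime p) (hord : ¬ (p : ℤ) ∣ W.frobeniusTrace p)
    (hsurj : ∀ n : ℕ, W.HasSurjectiveModNGaloisRep (p ^ n : ℕ)) (hL : W.entireLFunction 1 ≠ 0)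
    (hϖ : ∀ [NeZero (W.conductorNorm ℤ)] (f : CuspForm (Gamma0 (W.conductorNorm ℤ)) 2),
      IsNewformOf W f → ∀ ϖ : ℚ, (ϖ : ℝ) * W.realPeriodRat = plusPeriod f → padicValRat p ϖ = 0) :
    (∀ (κ : ZpExtension ℚ p) (γ : Field.absoluteGaloisGroup ℚ),
        κ.IsCyclotomic → κ.IsTopGenerator γ → IsCyclotomicVariable p γ →
      ∀ [NeZero (W.conductorNorm ℤ)] (f : CuspForm (Gamma0 (W.conductorNorm ℤ)) 2),
        IsNewformOf W f → ∀ (ϖ : ℚ), (ϖ : ℝ) * W.realPeriodRat = plusPeriod f →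
      ∀ (D : W.SelmerDualData κ γ), D.IsTorsion ∧
        ∃ g : IwasawaAlgebra p, D.charIdeal = Ideal.span {g} ∧
          iwasawaToPowerSeries p g =
            PowerSeries.C (ϖ : ℚ_[p]) * padicLFunction f (unitRoot W p : ℚ_[p])) ↔
    BSDp W p := by
  have hr0 : W.analyticRank = 0 := analyticRank_eq_zero_of_entireLFunction_one_ne_zero hL
  constructor
  · intro hMC
    exact Typed.bsdp_of_missingPPartAt W p hGZK (by rw [hr0]; exact zero_le_one)
      (missingPPartAt_of_mainConjecture hGr hmod hGZK W p hp hgood hord hL hMC)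
  · exact mainConjecture_of_bsdp_of_kato W p hGr hGZK hK hp hgood hord hsurj hL hϖ

end Surjective

/-! ### Class X10 at `p = 3`, rank `0`, surj(3) (X10a′ ∧ r = 0) -/

section X10

variable (W : WeierstrassCurve ℚ) [W.IsElliptic] [W.IsGloballyMinimal]

/-- On X10 (`3` good) with surj(3), `ρ̄_{E,3^n}` is surjective for every `n` (Wuthrich 2014 Lemma 20,
named fact `hW20`): Kato's condition (12.5.2) at `p = 3`. Bookkeeping.
[cite: Wuthrich2014, Lemma 20 (p. 400)] -/
theorem X10.surjective_pow_three_of_surj (hW20 : lemma20_surjective_threeAdic_of_semistable)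
    (hX : ClassX10 W 3) (hsurj : Surj W 3) : ∀ n : ℕ, W.HasSurjectiveModNGaloisRep (3 ^ n : ℕ) :=
  hW20 W (Or.inl hX.2.1.1) hsurj

/-- **X10a′ ∧ r = 0: Mazur's main conjecture for `(E, 3)` ⟺ the typed lower bound
`Typed.MissingLowerBoundAt W 3`** — i.e. WITHOUT the Yan–Zhu input the missing piece of the rank-`0`
branch of X10a′ (`Typed/X10.lean`, `X10.bsdp_three_rankZero_surj_of_missingLowerBoundAt`) is EXACTLY
the cyclotomic main conjecture at a good ordinary surjective `3` off (ram). Facts: Kato Thm. 17.4 (3)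
(`hK`), Greenberg Thm. 4.1 (`hGr`), modularity (`hmod`), Gross–Zagier–Kolyvagin (`hGZK`), Wuthrich
Lemma 20 (`hW20`), period unit (`hϖ`). [cite: Kato2004Asterisque, Thm. 17.4 (3) (p. 273)]
[cite: Wuthrich2014, Lemma 20 (p. 400)] [cite: GreenbergLNM1716, Thm. 4.1 and §5 (closing examples)]
[cite: SkinnerUrban2014, Thm. 3.6.9 (p. 45): the (ram) hypothesis] -/
theorem X10.mainConjecture_iff_missingLowerBoundAt_three_of_surj (hGr : greenberg_charValue_rankZero)
    (hmod : nonempty_modularParametrizationData)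
    (hGZK : rank_eq_analyticRank_of_analyticRank_le_one)
    (hW20 : lemma20_surjective_threeAdic_of_semistable)
    (hK : ∀ (κ : ZpExtension ℚ 3) (γ : Field.absoluteGaloisGroup ℚ) [NeZero (W.conductorNorm ℤ)]
      (f : CuspForm (Gamma0 (W.conductorNorm ℤ)) 2), kato_divisibility W 3 (κ := κ) (γ := γ) (f := f))
    (hϖ : ∀ [NeZero (W.conductorNorm ℤ)] (f : CuspForm (Gamma0 (W.conductorNorm ℤ)) 2),
      IsNewformOf W f → ∀ ϖ : ℚ, (ϖ : ℝ) * W.realPeriodRat = plusPeriod f → padicValRat 3 ϖ = 0)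
    (hX : ClassX10 W 3) (hsurj : Surj W 3) (hr0 : W.analyticRank = 0) :
    (∀ (κ : ZpExtension ℚ 3) (γ : Field.absoluteGaloisGroup ℚ),
        κ.IsCyclotomic → κ.IsTopGenerator γ → IsCyclotomicVariable 3 γ →
      ∀ [NeZero (W.conductorNorm ℤ)] (f : CuspForm (Gamma0 (W.conductorNorm ℤ)) 2),
        IsNewformOf W f → ∀ (ϖ : ℚ), (ϖ : ℝ) * W.realPeriodRat = plusPeriod f →
      ∀ (D : W.SelmerDualData κ γ), D.IsTorsion ∧
        ∃ g : IwasawaAlgebra 3, D.charIdeal = Ideal.span {g} ∧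
          iwasawaToPowerSeries 3 g =
            PowerSeries.C (ϖ : ℚ_[3]) * padicLFunction f (unitRoot W 3 : ℚ_[3])) ↔
    Typed.MissingLowerBoundAt W 3 := by
  haveI : NeZero (W.conductorNorm ℤ) := ⟨(W.conductorNorm_pos_holds).ne'⟩
  obtain ⟨Dm⟩ := hmod W
  have hL : W.entireLFunction 1 ≠ 0 :=
    (W.analyticRank_eq_zero_iff_holds Dm.isNewformOf.hasEntireLFunction).mp hr0
  exact mainConjecture_iff_missingLowerBoundAt_of_kato W 3 hGr hmod hGZK hK (by decide) hX.2.1.1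
    hX.2.1.2 (X10.surjective_pow_three_of_surj W hW20 hX hsurj) hL hϖ

/-- **X10a′ ∧ r = 0: Mazur's main conjecture for `(E, 3)` ⟺ Miller's `BSD(E, 3)`** (same facts).
With Yan–Zhu 2026 Thm. 4.15 (`Rank1Residual.bsdp_of_classX10_of_surj`) the right side holds
class-wide [PUB\*, flag `YZ26@3-BF-ERL-Ohta`]; per curve it holds flag-free wherever a PUBLISHED lever
closes it (the next two theorems). [cite: Kato2004Asterisque, Thm. 17.4 (3) (p. 273)]
[cite: Wuthrich2014, Lemma 20 (p. 400)] [cite: GreenbergLNM1716, Thm. 4.1 and §5 (closing examples)]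
[cite: Miller2011LMS, Def. 1.1 (arXiv:1010.2431 p. 3)] -/
theorem X10.mainConjecture_iff_bsdp_three_of_surj (hGr : greenberg_charValue_rankZero)
    (hmod : nonempty_modularParametrizationData)
    (hGZK : rank_eq_analyticRank_of_analyticRank_le_one)
    (hW20 : lemma20_surjective_threeAdic_of_semistable)
    (hK : ∀ (κ : ZpExtension ℚ 3) (γ : Field.absoluteGaloisGroup ℚ) [NeZero (W.conductorNorm ℤ)]
      (f : CuspForm (Gamma0 (W.conductorNorm ℤ)) 2), kato_divisibility W 3 (κ := κ) (γ := γ) (f := f))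
    (hϖ : ∀ [NeZero (W.conductorNorm ℤ)] (f : CuspForm (Gamma0 (W.conductorNorm ℤ)) 2),
      IsNewformOf W f → ∀ ϖ : ℚ, (ϖ : ℝ) * W.realPeriodRat = plusPeriod f → padicValRat 3 ϖ = 0)
    (hX : ClassX10 W 3) (hsurj : Surj W 3) (hr0 : W.analyticRank = 0) :
    (∀ (κ : ZpExtension ℚ 3) (γ : Field.absoluteGaloisGroup ℚ),
        κ.IsCyclotomic → κ.IsTopGenerator γ → IsCyclotomicVariable 3 γ →
      ∀ [NeZero (W.conductorNorm ℤ)] (f : CuspForm (Gamma0 (W.conductorNorm ℤ)) 2),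
        IsNewformOf W f → ∀ (ϖ : ℚ), (ϖ : ℝ) * W.realPeriodRat = plusPeriod f →
      ∀ (D : W.SelmerDualData κ γ), D.IsTorsion ∧
        ∃ g : IwasawaAlgebra 3, D.charIdeal = Ideal.span {g} ∧
          iwasawaToPowerSeries 3 g =
            PowerSeries.C (ϖ : ℚ_[3]) * padicLFunction f (unitRoot W 3 : ℚ_[3])) ↔
    BSDp W 3 := by
  haveI : NeZero (W.conductorNorm ℤ) := ⟨(W.conductorNorm_pos_holds).ne'⟩
  obtain ⟨Dm⟩ := hmod W
  have hL : W.entireLFunction 1 ≠ 0 :=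
    (W.analyticRank_eq_zero_iff_holds Dm.isNewformOf.hasEntireLFunction).mp hr0
  exact mainConjecture_iff_bsdp_of_kato W 3 hGr hmod hGZK hK (by decide) hX.2.1.1 hX.2.1.2
    (X10.surjective_pow_three_of_surj W hW20 hX hsurj) hL hϖ

/-- **X10a′ ∧ r = 0 ∧ `3 ∤ #Ш_an` ⇒ Mazur's main conjecture for `(E, 3)`, from PUBLISHED theorems
alone** (no Yan–Zhu / Beilinson–Flach input, no (ram)): lever L1 (Wuthrich 2014 Prop. 21, `hW`, with
GZK and modularity: `Typed.X10.bsdp_three_rankZero_surj_of_shaAn_unit`) closes `BSD(E,3)`, and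
`X10.mainConjecture_iff_bsdp_three_of_surj` converts it. Census `N < 10⁴`: `3136g1@3`, `8624b1@3`
(`#Ш_an = 1`) — Mazur's main conjecture at `p = 3` for these curves is thus a theorem of the published
record. Per curve (the certificate is the lane's exact `#Ш_an`); NOT a class theorem.
[cite: Wuthrich2014, Prop. 21 (p. 400) and Lemma 20 (p. 400)] [cite: Kato2004Asterisque, Thm. 17.4 (3) (p. 273)]
[cite: GreenbergLNM1716, §5 (closing examples)] -/
theorem X10.mainConjecture_three_of_surj_of_shaAn_unit (hGr : greenberg_charValue_rankZero)
    (hmod : nonempty_modularParametrizationData) (hmodL : hasEntireLFunction_rat)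
    (hGZK : rank_eq_analyticRank_of_analyticRank_le_one) (hW : sha_dvd_analyticSha)
    (hW20 : lemma20_surjective_threeAdic_of_semistable)
    (hK : ∀ (κ : ZpExtension ℚ 3) (γ : Field.absoluteGaloisGroup ℚ) [NeZero (W.conductorNorm ℤ)]
      (f : CuspForm (Gamma0 (W.conductorNorm ℤ)) 2), kato_divisibility W 3 (κ := κ) (γ := γ) (f := f))
    (hϖ : ∀ [NeZero (W.conductorNorm ℤ)] (f : CuspForm (Gamma0 (W.conductorNorm ℤ)) 2),
      IsNewformOf W f → ∀ ϖ : ℚ, (ϖ : ℝ) * W.realPeriodRat = plusPeriod f → padicValRat 3 ϖ = 0)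
    (hX : ClassX10 W 3) (hsurj : Surj W 3) (hr0 : W.analyticRank = 0)
    (hunit : ∃ q : ℚ, shaAn W = (q : ℂ) ∧ padicValRat 3 q = 0) :
    ∀ (κ : ZpExtension ℚ 3) (γ : Field.absoluteGaloisGroup ℚ),
        κ.IsCyclotomic → κ.IsTopGenerator γ → IsCyclotomicVariable 3 γ →
      ∀ [NeZero (W.conductorNorm ℤ)] (f : CuspForm (Gamma0 (W.conductorNorm ℤ)) 2),
        IsNewformOf W f → ∀ (ϖ : ℚ), (ϖ : ℝ) * W.realPeriodRat = plusPeriod f →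
      ∀ (D : W.SelmerDualData κ γ), D.IsTorsion ∧
        ∃ g : IwasawaAlgebra 3, D.charIdeal = Ideal.span {g} ∧
          iwasawaToPowerSeries 3 g =
            PowerSeries.C (ϖ : ℚ_[3]) * padicLFunction f (unitRoot W 3 : ℚ_[3]) :=
  (X10.mainConjecture_iff_bsdp_three_of_surj W hGr hmod hGZK hW20 hK hϖ hX hsurj hr0).mpr
    (Typed.X10.bsdp_three_rankZero_surj_of_shaAn_unit hW hGZK hmodL W hX hr0 hsurj hunit)

/-- **X10a′ ∧ r = 0 ∧ `ord_3 #Ш_an ≤ 2` ∧ `3 ∣ #Ш(E/ℚ)` ⇒ Mazur's main conjecture for `(E, 3)`**, from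
PUBLISHED theorems (Wuthrich Prop. 21 `hW`, Cassels–Tate squareness `hCT`, GZK, modularity, Kato,
Greenberg, Lemma 20) plus ONE finite certificate `3 ∣ #Ш(E/ℚ)` (a `3`-descent with `Sel^{(3)} ≠ 0`
at a rank-`0` curve with `E(ℚ)[3] = 0`): `Typed.X10.bsdp_three_rankZero_surj_of_casselsTate_of_three_dvd`
closes `BSD(E,3)` and the iff converts it. Census `N < 2·10⁴`: the four rank-`0` X10a′ pairs with
`#Ш_an = 9` — `9800i1@3`, `15376i1@3`, `15376k1@3`, `15488h1@3` (X10-AUDIT.md §9.9, certificates run).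
Per curve; NOT a class theorem. [cite: Wuthrich2014, Prop. 21 (p. 400)] [cite: SilvermanAEC2009, Thm. X.4.14]
[cite: Kato2004Asterisque, Thm. 17.4 (3) (p. 273)] [cite: GreenbergLNM1716, §5 (closing examples)] -/
theorem X10.mainConjecture_three_of_surj_of_casselsTate_of_three_dvd
    (hGr : greenberg_charValue_rankZero) (hmod : nonempty_modularParametrizationData)
    (hmodL : hasEntireLFunction_rat) (hGZK : rank_eq_analyticRank_of_analyticRank_le_one)
    (hCT : exists_casselsTate_pairing (K := ℚ)) (hW : sha_dvd_analyticSha)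
    (hW20 : lemma20_surjective_threeAdic_of_semistable)
    (hK : ∀ (κ : ZpExtension ℚ 3) (γ : Field.absoluteGaloisGroup ℚ) [NeZero (W.conductorNorm ℤ)]
      (f : CuspForm (Gamma0 (W.conductorNorm ℤ)) 2), kato_divisibility W 3 (κ := κ) (γ := γ) (f := f))
    (hϖ : ∀ [NeZero (W.conductorNorm ℤ)] (f : CuspForm (Gamma0 (W.conductorNorm ℤ)) 2),
      IsNewformOf W f → ∀ ϖ : ℚ, (ϖ : ℝ) * W.realPeriodRat = plusPeriod f → padicValRat 3 ϖ = 0)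
    (hX : ClassX10 W 3) (hsurj : Surj W 3) (hr0 : W.analyticRank = 0)
    {q : ℚ} (hq : shaAn W = (q : ℂ)) (hv : padicValRat 3 q ≤ 2) (hdvd : 3 ∣ W.shaOrder) :
    ∀ (κ : ZpExtension ℚ 3) (γ : Field.absoluteGaloisGroup ℚ),
        κ.IsCyclotomic → κ.IsTopGenerator γ → IsCyclotomicVariable 3 γ →
      ∀ [NeZero (W.conductorNorm ℤ)] (f : CuspForm (Gamma0 (W.conductorNorm ℤ)) 2),
        IsNewformOf W f → ∀ (ϖ : ℚ), (ϖ : ℝ) * W.realPeriodRat = plusPeriod f →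
      ∀ (D : W.SelmerDualData κ γ), D.IsTorsion ∧
        ∃ g : IwasawaAlgebra 3, D.charIdeal = Ideal.span {g} ∧
          iwasawaToPowerSeries 3 g =
            PowerSeries.C (ϖ : ℚ_[3]) * padicLFunction f (unitRoot W 3 : ℚ_[3]) :=
  (X10.mainConjecture_iff_bsdp_three_of_surj W hGr hmod hGZK hW20 hK hϖ hX hsurj hr0).mpr
    (Typed.X10.bsdp_three_rankZero_surj_of_casselsTate_of_three_dvd hCT hW hGZK hmodL W hX hr0 hsurj
      hq hv hdvd)

end X10

end Literature.NumberTheory.EllipticCurves.Rank1Residual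

end
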